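import Summits.BirchSwinnertonDyer.BirchSwinnertonDyer.Theorems.GenusKolyvaginAtTwoShaCardDvdPowAtTwoPosTDefectOneBitLawExact
import Summits.BirchSwinnertonDyer.BirchSwinnertonDyer.Theorems.GenusKolyvaginAtTwoGenusDeepSupplyAtTwoNegDiscNarrowKFourCellShaTwoRank
import Literature.NumberTheory.EllipticCurves.SelmerProofs
import Literature.NumberTheory.EllipticCurves.SelmerTorsionRestriction
import Literature.NumberTheory.EllipticCurves.KummerMap
import Literature.NumberTheory.EllipticCurves.StrictSelmerTorsionLevelUniformBound
import HarnessLib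

/-!
# Route `GenusKolyvaginAtTwo`, residual `OffCutResidualAtTwo` (stmt-BirchSwinnertonDyer-25503), pen LINE 24 «strict_def2», stub X⁼² / budget B⁼²:
# THE KERNEL OF `res : H¹(ℚ, E) → H¹(K, E_K)` HAS AT MOST ONE NON-ZERO CLASS on the pair-sandwich frame, and the one-bit law is EXACT on
# EVERY one-block cell — `#Ш(E/K)[2^∞] = #Ш(E/ℚ)[2^∞]` when a class of `Ш(E/ℚ)` capitulates (K₄, K₄⁺), `= 4·#Ш(E/ℚ)[2^∞]` when none does (K₄⁼²)

Seat `bsd-line-gk2-p4` g27 (WIDTH-5 attach, cell `bsd-f1-sign2`), `--supports stmt-BirchSwinnertonDyer-25503` (helper; closes nothing); sequel of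
`…PosTDefectOneBitLaw` (p767735) and `…PosTDefectOneBitLawExact` (p767964).  THEOREMS ONLY (no definition, no new named fact, no `sorry`);
standard axioms.  §2–§3 are CONDITIONAL on the tree's named print fact `Literature.NumberTheory.EllipticCurves.casselsTate_pairing_resCor`
(Fisher 2003 Prop. 2.16), displayed as `hRC`, and on the two corestriction binders of the prequels.  **BSD is NOT proved by this file; nothing
is closed.**

* §1 **`eq_of_resBaseChange_eq_zero_of_frame`** (UNCONDITIONAL) — on the frame (`[K:ℚ] = 2`, `τ ≠ 1`, `E(K)[2] = 0`, `rank E(K) ≤ 1`, `y ∈ E(K)`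
  with `τy + y` torsion and `2^(M+1) ∤ y`) any two NON-ZERO classes of `H¹(ℚ, E)` killed by `res` are EQUAL: `#ker(res) ≤ 2` (the Kramer class is
  the only one).  Mechanism: `res η = 0 ⟹ 2η = 0 ⟹ η = ι(s)`, `s ∈ H¹(ℚ, E[2])` (Kummer, `range_torsionH1ToH1_eq_torsionBy_holds`); `ι_K(res s) =
  res(ι s) = 0 ⟹ res s = κ_K(P)` (Kummer exactness over `K`); `P ∉ 2E(K)` (else `res s = 0`, `s = 0` by `resTorsion_injective_of_noTorsion`);
  two points outside `2E(K)` differ by `2E(K)` (frame package), so the two `res s` agree, hence the two `s`, hence the two `η`.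
  `natCard_le_two_of_forall_eq` — the counting form.
* §2 **`natCard_torsionBy_mul_natCard_le_four_mul_natCard_shaPrimary_of_adjoint_of_frame`** — for ANY position of the Kramer class:
  **`#Ш(E/K)[2] · #Ш(E/ℚ)[2^∞] ≤ 4 · #Ш(E/K)[2^∞]`** (`Y ↪ Hom(cor X, ℚ/ℤ)` has kernel inside `ker res ∩ Y`, of order `≤ 2` by §1; `cor` maps
  `X[2]` into `ker res ∩ Y`, so `#ker(cor|_X) ≥ #X[2]/2`).
* §3 **`natCard_shaPrimary_eq_natCard_shaPrimary_rat_of_adjoint_of_kramerClass_mem_of_frame`** — ONE-BLOCK CELLS WHERE A CLASS CAPITULATES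
  (`#Ш(E/K)[2] = 4` and a non-zero `2`-primary class of `Ш(E/ℚ)` dies in `Ш(E/K)`, i.e. Kramer's `Φ ≠ 0`: the K₄ and K₄⁺ cells, gk2-p5 p767715's
  `s_y`): **`#Ш(E/K)[2^∞] = #Ш(E/ℚ)[2^∞]`** (§2 gives `#Y ≤ #X`, the prequel's `two_mul_natCard_shaPrimary_le_of_kramerClass_mem` gives `#X ≤ 2#Y`,
  both are powers of `4`).  With `…OneBitLawExact` §3 (case A: `#X = 4·#Y`) the dichotomy of the memo (evidence #13 on 25503, §2(iii)) is typed: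
  **on a one-block cell `#X/#Y ∈ {1, 4}`, `= 1` iff the Kramer class lies in `Ш(E/ℚ)`** — so Kolyvagin-exactness over `K` (`#X = 4^(M₀)`, closed on
  the cut: U_T′/L⁺_T′ …) reads `#Ш(E/ℚ)[2^∞] = 4^(M₀)` on K₄/K₄⁺ and `= 4^(M₀−1)` on K₄⁼² (case A).

References: [Kramer1981] Thm. 1, Prop. 7, Thm. 2; [Fisher2003] Prop. 2.16; [GrossLMS1991] §5 Prop. 5.3; [SilvermanAEC2009] VIII §2, X.4.2;
[SerreGaloisCohomology1997] I §2.4 Prop. 9, §2.6 (b); [MilneADT2006] I Thm. 6.13.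
-/

set_option autoImplicit false
set_option linter.dupNamespace false -- `Summit.<P>.<Sub>` repeats `BirchSwinnertonDyer` (D-0017)

noncomputable section

open scoped Classical

namespace Summit.BirchSwinnertonDyer.BirchSwinnertonDyer.Theorems.GenusExact.PlusDescent.OneBit

open Literature.NumberTheory.EllipticCurves Literature.NumberTheory.GaloisRepresentations WeierstrassCurve NumberField
  IsDedekindDomain Field AddSubgroup
open Summit.BirchSwinnertonDyer.BirchSwinnertonDyer.Theorems.GenusExact.PlusDescent
open Summit.BirchSwinnertonDyer.BirchSwinnertonDyer.Theorems.GenusExact.SelmerDescent (mem_comap_resBaseChange_shaPrimary_iff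
  two_nsmul_eq_zero_of_resBaseChange_eq_zero)
open Literature.GroupTheory.FiniteAbelian (nonempty_addMonoidHom_ratAddCircle_addEquiv)

/-! ## §0 Counting: a finite pointed type whose non-zero elements coincide has at most two elements -/

/-- A finite type with a zero in which any two non-zero elements are equal has `Nat.card ≤ 2` (inject into `Bool` by `x ↦ (x = 0)`). [folklore] -/
theorem natCard_le_two_of_forall_eq {α : Type*} [Zero α] [Finite α] (h : ∀ a b : α, a ≠ 0 → b ≠ 0 → a = b) : Nat.card α ≤ 2 := by
  have hcard : Nat.card Bool = 2 := by simp
  rw [← hcard]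
  refine Nat.card_le_card_of_injective (fun a : α ↦ decide (a = 0)) fun a b hab ↦ ?_
  by_cases ha : a = 0 <;> by_cases hb : b = 0
  · rw [ha, hb]
  · simp [ha, hb] at hab
  · simp [ha, hb] at hab
  · exact h a b ha hb

/-! ## §1 The kernel of `res` on `H¹(ℚ, E)` has at most one non-zero class (frame; unconditional) -/

section Kernel

variable (W : WeierstrassCurve ℚ) [W.IsElliptic] (K : Type) [Field K] [NumberField K]

/-- **Any two non-zero classes of `H¹(ℚ, E)` killed by `res : H¹(ℚ, E) → H¹(K, E_K)` are equal**, on the pair-sandwich frame (`[K:ℚ] = 2`,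
`τ ≠ 1`, `E(K)[2] = 0`, `rank E(K) ≤ 1`, `y ∈ E(K)` with `τy + y` torsion and `2^(M+1) ∤ y`): `ker(res)` is the Kramer class and `0`
(`H¹(Gal(K/ℚ), E(K)) ≅ ℤ/2`).  Kummer theory: `res η = 0 ⟹ 2η = 0 ⟹ η = ι s`, `ι_K (res s) = 0 ⟹ res s = κ_K(P)` with `P ∉ 2E(K)`, and two
points outside `2E(K)` differ by `2E(K)` (`exists_framePackage_of_rank_le_one`).  [cite: Kramer1981, proof of Thm. 2] [cite: GrossLMS1991, §5 Prop. 5.3]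
[cite: SilvermanAEC2009, VIII §2] [cite: SerreGaloisCohomology1997, I §2.6 (b)] -/
theorem eq_of_resBaseChange_eq_zero_of_frame (h2 : Module.finrank ℚ K = 2) {τ : K ≃ₐ[ℚ] K} (hτ : τ ≠ 1)
    (h2tors : ∀ P : (W.baseChange K).toAffine.Point, (2 : ℤ) • P = 0 → P = 0)
    (hrk : (W.baseChange K).mordellWeilRank ≤ 1)
    (y : (W.baseChange K).toAffine.Point) (M : ℕ)
    (hndiv : ∀ Q : (W.baseChange K).toAffine.Point, ((2 ^ (M + 1) : ℕ) : ℤ) • Q ≠ y)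
    (hanti : IsOfFinAddOrder (Affine.Point.map (W' := W) (τ : K →ₐ[ℚ] K) y + y))
    {η₁ η₂ : W.galH1} (hη₁ : η₁ ≠ 0) (hη₂ : η₂ ≠ 0) (hres₁ : resBaseChange W K η₁ = 0) (hres₂ : resBaseChange W K η₂ = 0) :
    η₁ = η₂ := by
  haveI : Fact (Nat.Prime 2) := ⟨Nat.prime_two⟩
  haveI hell : (W.baseChange K).IsElliptic := inferInstanceAs ((W.map (algebraMap ℚ K)).IsElliptic)
  obtain ⟨θ, hθ, hc⟩ := Literature.NumberTheory.EllipticCurves.exists_sq_eq_discr_not_mem_range K h2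
  have h2tors' : ∀ P : (W.baseChange K).toAffine.Point, ((2 : ℕ) : ℤ) • P = 0 → P = 0 := fun P hP ↦ h2tors P (by exact_mod_cast hP)
  have hinj := GenusExact.EigenClassesFinite.resTorsion_injective_of_noTorsion W K h2 hθ hc ((2 : ℕ) : ℤ) h2tors'
  have hdivK : ∀ P : geomPoints (W.baseChange K), ∃ Q : geomPoints (W.baseChange K), ((2 : ℕ) : ℤ) • Q = P :=
    (W.baseChange K).zsmul_geomPoints_surjective_of_charZero (by norm_num)
  obtain ⟨Q₀, m, -, -, -, -, -, -, hV2⟩ := exists_framePackage_of_rank_le_one W K h2 hτ h2tors hrk y M hndiv hanti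
  -- each `ηᵢ` is `ι sᵢ` with `res sᵢ = κ_K(Pᵢ)`, `Pᵢ ∉ 2E(K)`
  have key : ∀ {η : W.galH1}, η ≠ 0 → resBaseChange W K η = 0 →
      ∃ (s : galH1Torsion W ((2 : ℕ) : ℤ)) (P : (W.baseChange K).toAffine.Point), torsionH1ToH1 W ((2 : ℕ) : ℤ) s = η ∧
        resTorsion W K ((2 : ℕ) : ℤ) s = kummerMapTorsion (W.baseChange K) ((2 : ℕ) : ℤ) hdivK P ∧
        ¬ ∃ S : (W.baseChange K).toAffine.Point, (2 : ℤ) • S = P := by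
    intro η hη hres
    have h2η : 2 • η = 0 := two_nsmul_eq_zero_of_resBaseChange_eq_zero W h2 hτ hres
    have hηt : η ∈ AddSubgroup.torsionBy W.galH1 ((2 : ℕ) : ℤ) :=
      AddSubgroup.torsionBy.nsmul_iff.mpr (by exact_mod_cast h2η)
    rw [← range_torsionH1ToH1_eq_torsionBy_holds W (by norm_num)] at hηt
    obtain ⟨s, hs⟩ := AddMonoidHom.mem_range.mp hηt
    have hι : torsionH1ToH1 (W.baseChange K) ((2 : ℕ) : ℤ) (resTorsion W K ((2 : ℕ) : ℤ) s) = 0 := by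
      rw [torsionH1ToH1_resTorsion, hs, hres]
    obtain ⟨P, hP⟩ := AddMonoidHom.mem_range.mp
      (mem_range_kummerMapTorsion_of_torsionH1ToH1_eq_zero (W.baseChange K) ((2 : ℕ) : ℤ) hdivK _ hι)
    refine ⟨s, P, hs, hP.symm, fun ⟨S, hS⟩ ↦ hη ?_⟩
    have hκ0 : kummerMapTorsion (W.baseChange K) ((2 : ℕ) : ℤ) hdivK P = 0 := by
      rw [← AddMonoidHom.mem_ker, kummerMapTorsion_ker]
      exact ⟨S, by rw [zsmulAddGroupHom_apply]; exact_mod_cast hS⟩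
    have hs0 : s = 0 := hinj (by rw [hP.symm, hκ0, map_zero])
    rw [← hs, hs0, map_zero]
  obtain ⟨s₁, P₁, hs₁, hP₁, hn₁⟩ := key hη₁ hres₁
  obtain ⟨s₂, P₂, hs₂, hP₂, hn₂⟩ := key hη₂ hres₂
  -- `P₁ − P₂ ∈ 2E(K)`, so `κ_K(P₁) = κ_K(P₂)`
  obtain ⟨S, hS⟩ := hV2 P₁ P₂ hn₁ hn₂
  have hκ : kummerMapTorsion (W.baseChange K) ((2 : ℕ) : ℤ) hdivK P₁ = kummerMapTorsion (W.baseChange K) ((2 : ℕ) : ℤ) hdivK P₂ := by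
    have h := map_sub (kummerMapTorsion (W.baseChange K) ((2 : ℕ) : ℤ) hdivK) P₁ P₂
    rw [← hS, show (2 : ℤ) • S = (2 : ℕ) • S by norm_cast, map_nsmul,
      nsmul_galH1Torsion_natCast_eq_zero (W.baseChange K) 2] at h
    exact (sub_eq_zero.mp h.symm)
  have hs : s₁ = s₂ := hinj (by rw [hP₁, hP₂, hκ])
  rw [← hs₁, ← hs₂, hs]

end Kernel

/-! ## §2 For any position of the Kramer class: `#Ш(E/K)[2] · #Ш(E/ℚ)[2^∞] ≤ 4 · #Ш(E/K)[2^∞]`, modulo adjointness -/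

section AnyPhi

variable (W : WeierstrassCurve ℚ) [W.IsElliptic] (K : Type) [Field K] [NumberField K]

set_option maxHeartbeats 400000 in -- one long elaboration: Kummer kernel + pairing injection + two kernel/image counts
/-- **`#Ш(E/K)[2] · #Ш(E/ℚ)[2^∞] ≤ 4 · #Ш(E/K)[2^∞]` on the frame, whatever the position of the Kramer class**, modulo Cassels–Tate
res/cor adjointness (`hRC`) and the cor binders: `y ↦ ⟨y, cor ·⟩_ℚ = ⟨res y, ·⟩_K` maps `Y = Ш(E/ℚ)[2^∞]` to `Hom(cor X, ℚ/ℤ)` with kernel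
inside `ker res` (§1 of `…OneBitLawExact`: trivial left kernel on `X`), of order `≤ 2` (§1 here); and `cor` maps `X[2]` into `ker res` (`res cor z =
2z = 0`, `τ_* = id`), so `#ker(cor|_X) ≥ #X[2]/2`: `#X[2]·#Y ≤ #X[2]·2·#cor X ≤ 4·#ker(cor|_X)·#cor X = 4·#X`.
[cite: Fisher2003, Prop. 2.16] [cite: Kramer1981, Thm. 1, Thm. 2] [cite: MilneADT2006, I Thm. 6.13] [cite: GrossLMS1991, §5 Prop. 5.3] -/
theorem natCard_torsionBy_mul_natCard_le_four_mul_natCard_shaPrimary_of_adjoint_of_frame (hIQ : IsImaginaryQuadratic K)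
    {σ : K ≃ₐ[ℚ] K} (hσ1 : σ ≠ 1) (hRC : casselsTate_pairing_resCor K σ hIQ.1 hσ1)
    (h2tors : ∀ P : (W.baseChange K).toAffine.Point, (2 : ℤ) • P = 0 → P = 0)
    (hrk : (W.baseChange K).mordellWeilRank ≤ 1)
    (y : (W.baseChange K).toAffine.Point) (M : ℕ)
    (hndiv : ∀ Q : (W.baseChange K).toAffine.Point, ((2 ^ (M + 1) : ℕ) : ℤ) • Q ≠ y)
    (hanti : IsOfFinAddOrder (Affine.Point.map (W' := W) (σ : K →ₐ[ℚ] K) y + y))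
    [Finite (AddCommGroup.primaryComponent (↥W.sha) 2)] [Finite (AddCommGroup.primaryComponent (↥(W.baseChange K).sha) 2)]
    (hT0 : ∀ x ∈ AddCommGroup.primaryComponent (↥(W.quadraticTwist (NumberField.discr K : ℚ)).sha) 2, x = 0)
    (hcorT : ∀ c : ((W.quadraticTwist (NumberField.discr K : ℚ)).baseChange K).galH1,
        c ∈ ((W.quadraticTwist (NumberField.discr K : ℚ)).baseChange K).sha →
          corBaseChange K (W.quadraticTwist (NumberField.discr K : ℚ)) σ hIQ.1 hσ1 c ∈ (W.quadraticTwist (NumberField.discr K : ℚ)).sha)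
    (hcorE : ∀ c : (W.baseChange K).galH1, c ∈ (W.baseChange K).sha → corBaseChange K W σ hIQ.1 hσ1 c ∈ W.sha) :
    Nat.card (AddSubgroup.torsionBy (↥(W.baseChange K).sha) ((2 : ℕ) : ℤ)) * Nat.card (AddCommGroup.primaryComponent (↥W.sha) 2) ≤
      4 * Nat.card (AddCommGroup.primaryComponent (↥(W.baseChange K).sha) 2) := by
  haveI : Fact (Nat.Prime 2) := ⟨Nat.prime_two⟩
  haveI hell : (W.baseChange K).IsElliptic := inferInstanceAs ((W.map (algebraMap ℚ K)).IsElliptic)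
  have h2 : Module.finrank ℚ K = 2 := hIQ.1
  -- §1: any two non-zero classes killed by `res` coincide
  have hker1 : ∀ {η₁ η₂ : W.galH1}, η₁ ≠ 0 → η₂ ≠ 0 → resBaseChange W K η₁ = 0 → resBaseChange W K η₂ = 0 → η₁ = η₂ :=
    fun hη₁ hη₂ hr₁ hr₂ ↦ eq_of_resBaseChange_eq_zero_of_frame W K h2 hσ1 h2tors hrk y M hndiv hanti hη₁ hη₂ hr₁ hr₂
  obtain ⟨Bℚ, BK, ⟨hℚi, -⟩, ⟨hKi, -⟩, hadj⟩ := hRC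
  set X : AddSubgroup ↥(W.baseChange K).sha := AddCommGroup.primaryComponent (↥(W.baseChange K).sha) 2 with hX
  set TX : AddSubgroup ↥(W.baseChange K).sha := AddSubgroup.torsionBy (↥(W.baseChange K).sha) ((2 : ℕ) : ℤ) with hTX
  set Y : AddSubgroup ↥W.sha := AddCommGroup.primaryComponent (↥W.sha) 2 with hY
  set res := resBaseChange W K with hres
  set cor := corBaseChange K W σ h2 hσ1 with hcor
  set corSha : ↥(W.baseChange K).sha →+ ↥W.sha :=
    (cor.comp (W.baseChange K).sha.subtype).codRestrict W.sha (fun c ↦ hcorE c c.2) with hcorSha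
  have hcorY : ∀ x : ↥(W.baseChange K).sha, x ∈ X → corSha x ∈ Y := by
    intro x hx
    obtain ⟨k, hk⟩ := (AddCommGroup.mem_primaryComponent).mp hx
    exact (AddCommGroup.mem_primaryComponent).mpr ⟨k, by rw [← map_nsmul, hk, map_zero]⟩
  set C : AddSubgroup ↥W.sha := X.map corSha with hC
  haveI hCfin : Finite C := by
    have h : ((C : AddSubgroup ↥W.sha) : Set ↥W.sha).Finite := by rw [hC, AddSubgroup.coe_map]; exact (Set.toFinite _).image _
    exact h.to_subtype
  -- (a) `#X = #ker(cor|_X) · #C`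
  have hsplitX := natCard_eq_natCard_ker_mul_natCard_map X corSha
  -- (b) `#X[2] ≤ 2 · #ker(cor|_X)`: `cor` maps `X[2]` into `ker res`, which has ≤ 2 elements
  have hTXle : TX ≤ X := fun z hz ↦
    (AddCommGroup.mem_primaryComponent).mpr ⟨1, by rw [pow_one]; exact AddSubgroup.torsionBy.nsmul_iff.mp hz⟩
  haveI : Finite TX := Finite.of_injective (AddSubgroup.inclusion hTXle) (AddSubgroup.inclusion_injective hTXle)
  have hsplitT := natCard_eq_natCard_ker_mul_natCard_map TX corSha
  have hres0 : ∀ z : ↥(W.baseChange K).sha, z ∈ TX → res ((corSha z : ↥W.sha) : W.galH1) = 0 := by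
    intro z hz
    have hz2 : 2 • (z : (W.baseChange K).galH1) = 0 := by
      have h := AddSubgroup.torsionBy.nsmul_iff.mp hz
      have h' := congrArg (fun u : ↥(W.baseChange K).sha ↦ (u : (W.baseChange K).galH1)) h
      simpa only [AddSubgroupClass.coe_nsmul, ZeroMemClass.coe_zero] using h'
    have hfix := conjH1Points_eq_self_of_shaPrimary W K hIQ hσ1 hT0 hcorT (z : (W.baseChange K).galH1) z.2 ⟨1, by rw [pow_one]; exact hz2⟩
    change res (cor (z : (W.baseChange K).galH1)) = 0
    rw [hres, hcor, resBaseChange_corBaseChange K W σ h2 hσ1 (isLiftOfAut_liftAut σ), hfix, ← two_nsmul, hz2]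
  haveI hmapTfin : Finite (TX.map corSha) := by
    have h : ((TX.map corSha : AddSubgroup ↥W.sha) : Set ↥W.sha).Finite := by rw [AddSubgroup.coe_map]; exact (Set.toFinite _).image _
    exact h.to_subtype
  have hmapT : Nat.card (TX.map corSha) ≤ 2 := by
    refine natCard_le_two_of_forall_eq fun a b ha hb ↦ ?_
    obtain ⟨za, hza, hza'⟩ := AddSubgroup.mem_map.mp a.2
    obtain ⟨zb, hzb, hzb'⟩ := AddSubgroup.mem_map.mp b.2
    have ha' : ((a : ↥W.sha) : W.galH1) ≠ 0 := fun h ↦ ha (Subtype.ext (Subtype.ext h))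
    have hb' : ((b : ↥W.sha) : W.galH1) ≠ 0 := fun h ↦ hb (Subtype.ext (Subtype.ext h))
    have hra : res ((a : ↥W.sha) : W.galH1) = 0 := by rw [← hza']; exact hres0 za hza
    have hrb : res ((b : ↥W.sha) : W.galH1) = 0 := by rw [← hzb']; exact hres0 zb hzb
    exact Subtype.ext (Subtype.ext (hker1 ha' hb' hra hrb))
  have hkerT : Nat.card (corSha.comp TX.subtype).ker ≤ Nat.card (corSha.comp X.subtype).ker := by
    refine Nat.card_le_card_of_injective
      (fun k ↦ (⟨⟨((k : TX) : ↥(W.baseChange K).sha), hTXle (k : TX).2⟩, (AddMonoidHom.mem_ker).mpr ?_⟩ : (corSha.comp X.subtype).ker)) ?_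
    · have hk := (AddMonoidHom.mem_ker).mp k.2
      exact hk
    · intro k₁ k₂ h
      exact Subtype.ext (Subtype.ext (congrArg (fun u : (corSha.comp X.subtype).ker ↦ ((u : X) : ↥(W.baseChange K).sha)) h))
  have hTX2 : Nat.card TX ≤ 2 * Nat.card (corSha.comp X.subtype).ker := by
    calc Nat.card TX = Nat.card (corSha.comp TX.subtype).ker * Nat.card (TX.map corSha) := hsplitT
      _ ≤ Nat.card (corSha.comp X.subtype).ker * 2 := Nat.mul_le_mul hkerT hmapT
      _ = 2 * Nat.card (corSha.comp X.subtype).ker := mul_comm _ _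
  -- (c) `#Y ≤ 2 · #C`: `y ↦ ⟨y, ·⟩_ℚ|_C` has kernel inside `ker res`, of order ≤ 2
  obtain ⟨e⟩ := nonempty_addMonoidHom_ratAddCircle_addEquiv C
  haveI : Finite (C →+ AddCircle (1 : ℚ)) := Finite.of_equiv _ e.toEquiv.symm
  have horthY : ∀ yy : ↥W.sha, yy ∈ Y → (∀ c ∈ C, Bℚ W yy c = 0) → res (yy : W.galH1) = 0 := by
    intro yy hyy hyC
    obtain ⟨k, hk⟩ := (AddCommGroup.mem_primaryComponent).mp hyy
    have hresX : shaRestriction W K yy ∈ X := (AddCommGroup.mem_primaryComponent).mpr ⟨k, by rw [← map_nsmul, hk, map_zero]⟩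
    have horth : ∀ x ∈ X, BK (W.baseChange K) (shaRestriction W K yy) x = 0 := by
      intro x hx
      rw [hadj W yy x (hcorE _ x.2)]
      have hc : (⟨cor (x : (W.baseChange K).galH1), hcorE _ x.2⟩ : ↥W.sha) = corSha x := Subtype.ext rfl
      rw [hc]
      exact hyC _ (AddSubgroup.mem_map.mpr ⟨x, hx, rfl⟩)
    have h0 : shaRestriction W K yy = 0 :=
      eq_zero_of_forall_apply_primaryComponent_eq_zero (W.baseChange K).isTorsion_sha (BK (W.baseChange K))
        (fun x hx ↦ ((hKi (W.baseChange K)).2 x).mp hx) hresX horth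
    rw [hres, ← coe_shaRestriction_apply, h0]; rfl
  set Ψ : ↥W.sha →+ (C →+ AddCircle (1 : ℚ)) := (AddMonoidHom.compHom' C.subtype).comp (Bℚ W) with hΨ
  have hΨapp : ∀ (yy : ↥W.sha) (c : C), Ψ yy c = Bℚ W yy (c : ↥W.sha) := fun _ _ ↦ rfl
  have hsplitY := natCard_eq_natCard_ker_mul_natCard_map Y Ψ
  haveI : Finite (Ψ.comp Y.subtype).ker := inferInstance
  have hkerY : Nat.card (Ψ.comp Y.subtype).ker ≤ 2 := by
    refine natCard_le_two_of_forall_eq fun a b ha hb ↦ ?_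
    have hzero : ∀ k : (Ψ.comp Y.subtype).ker, ∀ c ∈ C, Bℚ W ((k : Y) : ↥W.sha) c = 0 := by
      intro k c hc
      have hk := (AddMonoidHom.mem_ker).mp k.2
      have h' := congrArg (fun f : C →+ AddCircle (1 : ℚ) ↦ f ⟨c, hc⟩) hk
      simpa only [AddMonoidHom.comp_apply, AddSubgroup.coe_subtype, hΨapp, AddMonoidHom.zero_apply] using h'
    have ha' : (((a : Y) : ↥W.sha) : W.galH1) ≠ 0 := fun h ↦ ha (Subtype.ext (Subtype.ext (Subtype.ext h)))
    have hb' : (((b : Y) : ↥W.sha) : W.galH1) ≠ 0 := fun h ↦ hb (Subtype.ext (Subtype.ext (Subtype.ext h)))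
    exact Subtype.ext (Subtype.ext (Subtype.ext (hker1 ha' hb' (horthY _ (a : Y).2 (hzero a)) (horthY _ (b : Y).2 (hzero b)))))
  haveI hmapYfin : Finite (Y.map Ψ) := by
    have h : ((Y.map Ψ : AddSubgroup (C →+ AddCircle (1 : ℚ))) : Set (C →+ AddCircle (1 : ℚ))).Finite := Set.toFinite _
    exact h.to_subtype
  have hmapY : Nat.card (Y.map Ψ) ≤ Nat.card C := by
    rw [← Nat.card_congr e.toEquiv]
    exact Nat.card_le_card_of_injective (fun f : Y.map Ψ ↦ (f : C →+ AddCircle (1 : ℚ))) Subtype.val_injective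
  have hY2 : Nat.card Y ≤ 2 * Nat.card C := by
    calc Nat.card Y = Nat.card (Ψ.comp Y.subtype).ker * Nat.card (Y.map Ψ) := hsplitY
      _ ≤ 2 * Nat.card C := Nat.mul_le_mul hkerY hmapY
  -- (d) combine
  calc Nat.card TX * Nat.card Y ≤ (2 * Nat.card (corSha.comp X.subtype).ker) * (2 * Nat.card C) := Nat.mul_le_mul hTX2 hY2
    _ = 4 * (Nat.card (corSha.comp X.subtype).ker * Nat.card C) := by ring
    _ = 4 * Nat.card X := by rw [← hsplitX]

/-! ## §3 One-block cells where a class capitulates (K₄, K₄⁺): `#Ш(E/K)[2^∞] = #Ш(E/ℚ)[2^∞]` -/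

/-- **THE ONE-BIT LAW IS EXACT WHEN A CLASS CAPITULATES: `#Ш(E/K)[2^∞] = #Ш(E/ℚ)[2^∞]`** on a one-block cell (`#Ш(E/K)[2] = 4`) of the frame
where some non-zero `2`-primary class of `Ш(E/ℚ)` dies in `Ш(E/K)` (Kramer's `Φ ≠ 0`: the K₄ / K₄⁺ cells, where the capitulating class is
gk2-p5's `s_y`), modulo `hRC` and the cor binders: §2 gives `4·#Y ≤ 4·#X`, the prequel's `two_mul_natCard_shaPrimary_le_of_kramerClass_mem` gives
`2·#X ≤ 4·#Y`, and `#X = 4^t`, `#Y = 4^a` (Cassels–Tate over `K` and over `ℚ`) force `t = a`.  Together with `…OneBitLawExact` §3 (no capitulation: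
`#X = 4·#Y`): on one-block cells `#X/#Y ∈ {1, 4}`, decided by the position of the Kramer class.
[cite: Fisher2003, Prop. 2.16] [cite: Kramer1981, Thm. 1, Prop. 7, Thm. 2] [cite: SilvermanAEC2009, Thm. X.4.14] -/
theorem natCard_shaPrimary_eq_natCard_shaPrimary_rat_of_adjoint_of_kramerClass_mem_of_frame (hIQ : IsImaginaryQuadratic K)
    {σ : K ≃ₐ[ℚ] K} (hσ1 : σ ≠ 1) (hRC : casselsTate_pairing_resCor K σ hIQ.1 hσ1)
    (h2tors : ∀ P : (W.baseChange K).toAffine.Point, (2 : ℤ) • P = 0 → P = 0)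
    (hrk : (W.baseChange K).mordellWeilRank ≤ 1)
    (y : (W.baseChange K).toAffine.Point) (M : ℕ)
    (hndiv : ∀ Q : (W.baseChange K).toAffine.Point, ((2 ^ (M + 1) : ℕ) : ℤ) • Q ≠ y)
    (hanti : IsOfFinAddOrder (Affine.Point.map (W' := W) (σ : K →ₐ[ℚ] K) y + y))
    [Finite (AddCommGroup.primaryComponent (↥W.sha) 2)] [Finite (AddCommGroup.primaryComponent (↥(W.baseChange K).sha) 2)]
    (hT0 : ∀ x ∈ AddCommGroup.primaryComponent (↥(W.quadraticTwist (NumberField.discr K : ℚ)).sha) 2, x = 0)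
    (hcorT : ∀ c : ((W.quadraticTwist (NumberField.discr K : ℚ)).baseChange K).galH1,
        c ∈ ((W.quadraticTwist (NumberField.discr K : ℚ)).baseChange K).sha →
          corBaseChange K (W.quadraticTwist (NumberField.discr K : ℚ)) σ hIQ.1 hσ1 c ∈ (W.quadraticTwist (NumberField.discr K : ℚ)).sha)
    (hcorE : ∀ c : (W.baseChange K).galH1, c ∈ (W.baseChange K).sha → corBaseChange K W σ hIQ.1 hσ1 c ∈ W.sha)
    (hKr : ∃ η : W.galH1, η ∈ (AddCommGroup.primaryComponent (↥W.sha) 2).map W.sha.subtype ∧ η ≠ 0 ∧ resBaseChange W K η = 0)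
    (hX4 : Nat.card (AddSubgroup.torsionBy (↥(W.baseChange K).sha) ((2 : ℕ) : ℤ)) = 4) :
    Nat.card (AddCommGroup.primaryComponent (↥(W.baseChange K).sha) 2) = Nat.card (AddCommGroup.primaryComponent (↥W.sha) 2) := by
  haveI : Fact (Nat.Prime 2) := ⟨Nat.prime_two⟩
  -- `#Y ≤ #X`
  have hle := natCard_torsionBy_mul_natCard_le_four_mul_natCard_shaPrimary_of_adjoint_of_frame W K hIQ hσ1 hRC h2tors hrk y M hndiv hanti
    hT0 hcorT hcorE
  rw [hX4] at hle
  have hYX : Nat.card (AddCommGroup.primaryComponent (↥W.sha) 2) ≤ Nat.card (AddCommGroup.primaryComponent (↥(W.baseChange K).sha) 2) :=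
    Nat.le_of_mul_le_mul_left hle (by norm_num)
  -- `2·#X ≤ 4·#Y`
  have hge := two_mul_natCard_shaPrimary_le_of_kramerClass_mem W K hIQ hσ1 hT0 hcorT hcorE hKr
  rw [hX4] at hge
  -- both are powers of `4`
  obtain ⟨t, ht⟩ := exists_natCard_shaPrimary_baseChange_eq_pow W K
  obtain ⟨e', he'⟩ := exists_natCard_addPrimaryComponent_eq_pow (A := ↥W.sha) 2
  obtain ⟨r, hr⟩ := CasselsTateNumberField.isSquare_natCard_primaryComponent_sha W 2
  have hr2 : r * r = 2 ^ e' := by rw [← hr, he']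
  obtain ⟨a, -, rfl⟩ := (Nat.dvd_prime_pow Nat.prime_two).mp (⟨r, hr2.symm⟩ : r ∣ 2 ^ e')
  have ha : Nat.card (AddCommGroup.primaryComponent (↥W.sha) 2) = 2 ^ (2 * a) := by rw [hr, ← pow_add, two_mul]
  rw [ht, ha] at hYX hge ⊢
  have h1 : 2 * a ≤ 2 * t := (Nat.pow_le_pow_iff_right (by norm_num)).mp hYX
  have h2' : 2 ^ (2 * t + 1) ≤ 2 ^ (2 * a + 2) := by
    calc 2 ^ (2 * t + 1) = 2 * 2 ^ (2 * t) := by ring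
      _ ≤ 4 * 2 ^ (2 * a) := hge
      _ = 2 ^ (2 * a + 2) := by ring
  have h3 : 2 * t + 1 ≤ 2 * a + 2 := (Nat.pow_le_pow_iff_right (by norm_num)).mp h2'
  congr 1
  omega

end AnyPhi

end Summit.BirchSwinnertonDyer.BirchSwinnertonDyer.Theorems.GenusExact.PlusDescent.OneBit

end
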